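import Literature.NumberTheory.EllipticCurves.Rank1Residual.Typed.X6
import Literature.NumberTheory.EllipticCurves.Rank1Residual.Typed.X7
import Literature.NumberTheory.EllipticCurves.Rank1Residual.Typed.X8
import Literature.NumberTheory.EllipticCurves.Isogeny
import Summits.BirchSwinnertonDyer.Rank1Residual.Supersingular.KobayashiMainConjecture
import Summits.BirchSwinnertonDyer.Rank1Residual.Supersingular.KobayashiMainConjectureX7
import Summits.BirchSwinnertonDyer.Rank1Residual.Supersingular.SignedRankOneCorA5
import Summits.BirchSwinnertonDyer.Rank1Residual.Supersingular.SharpFlatRankZeroReal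
import Summits.BirchSwinnertonDyer.Rank1Residual.Partition.MainConjecturesSignedLowerDivisibilityClasses
import Summits.BirchSwinnertonDyer.Rank1Residual.Partition.MainConjecturesCMSupersingular
import Summits.BirchSwinnertonDyer.Rank1Residual.Supersingular.SignedSupersingularLeaf
import HarnessLib

set_option linter.dupNamespace false
set_option autoImplicit false

/-!
# Rung K3 (ladder BSD) — Theorems-side BRIDGE for the route `SignedLowerHalves`

HUMAN RULINGS D-0059 / D-0061 (cell `bsd-ssimc`, planner g7; director-bsd 2026-08-25T19:23Z route
mechanics: a route file may import only `Mathlib` / `Literature` / `HarnessLib` /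
`Summits.BirchSwinnertonDyer.Statement` / `Summits.BirchSwinnertonDyer.BirchSwinnertonDyer.Theorems.*`).
This file is the bridge: it imports the rung-K3 CLOSED LEAF
`Summit.BirchSwinnertonDyer.Rank1Residual.Supersingular.SignedSupersingular`
(`Rank1Residual/Supersingular/SignedSupersingularLeaf.lean`, p404852) together with the tree's
sorry-free CLASS ROADS of the three supersingular corners, and proves the ASSEMBLED THEOREM
`signedSupersingular_of_lowerHalves`: the leaf follows from
* (X_B1) the Eisenstein (lower) half of Kobayashi's signed main conjecture for one sign on corner X6
  (semistable; announced BSTW arXiv:2409.01350 Part II Thm. 1.18, PRE — a HYPOTHESIS here);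
* (X_B2, large image) the same lower half on corner X7 (non-semistable), non-CM, `a_p = 0`,
  `ρ̄_{E,p}` surjective (conjectural — HYPOTHESIS);
* (X_B2, small image) Kobayashi's signed main conjecture as an EQUALITY for one sign on corner X7,
  non-CM, `a_p = 0`, `ρ̄_{E,p}` not surjective (conjectural — HYPOTHESIS; the equality is needed since
  Kobayashi's Thm. 4.1 is integral only for surjective image);
* (X_B3) the lower half of Sprung's ♯/♭ main conjecture for one colour on corner X8 (`p = 3`,
  `a_3 = ±3`) on Sprung's real objects — exactly the binders of
  `X8.missingInputAt_of_chromaticLowerDivisibility_of_surj` (conjectural — HYPOTHESIS);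
* (R8) the typed output `MissingPPartAt W 3` on corner X8 off its rank-0 large-image branch
  (the route's declared RESIDUAL — HYPOTHESIS);
* the PUBLISHED named facts the class roads consume, by name (Wuthrich 2014 Prop. 21; Kobayashi 2003
  Thm. 1.2 / 4.1; B. D. Kim 2013 Cor. 3.15; Burungale–Kobayashi–Ota 2024 Cor. A.5; the period
  relations; modularity; Gross–Zagier–Kolyvagin).
Nothing is asserted unconditionally: every open input is an explicit hypothesis, and the six
hypotheses are VERBATIM the six items of the route `SignedLowerHalves`, whose deciding theorem is
`closes := signedSupersingular_of_lowerHalves`. Proof = case analysis over the corners through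
`X6.bsdp_of_lowerDivisibility`, `X7.bsdp_of_lowerDivisibility_of_surj`,
`bsdp_of_kobayashiMainConjecture_of_analyticRank_eq_zero`,
`X7.bsdp_of_kobayashiMainConjecture_of_corA5_of_analyticRank_eq_one`,
`ClassX7.frobeniusTrace_eq_zero_of_five_le` (an X7 pair with `a_p ≠ 0` is an X8 pair),
`X8.missingInputAt_of_chromaticLowerDivisibility_of_surj`, `missingPPartAt_of_bsdp`.
-/

noncomputable section

namespace Summit.BirchSwinnertonDyer.BirchSwinnertonDyer.Theorems.SignedSupersingular

open Literature

/-- **Rung K3, assembled.** The rung-K3 leaf `SignedSupersingular` from the five open inputs of the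
route `SignedLowerHalves` (lower halves of the signed main conjectures on corners X6 / X7-large-image,
the signed main conjecture on X7-small-image, the ♯/♭ lower half on X8, the X8 residual) and the
published named facts. Every hypothesis is explicit; nothing open is consumed silently. -/
theorem signedSupersingular_of_lowerHalves
    (hB1 : ∀ (W : WeierstrassCurve ℚ) [W.IsElliptic] [W.IsGloballyMinimal] (p : ℕ) [Fact p.Prime], p ≠ 2 → Literature.NumberTheory.EllipticCurves.Rank1Residual.ClassX6 W p → ∃ ε : ℤˣ, Summit.BirchSwinnertonDyer.Rank1Residual.Supersingular.KobayashiLowerDivisibility W p ε)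
    (hB2 : ∀ (W : WeierstrassCurve ℚ) [W.IsElliptic] [W.IsGloballyMinimal] (p : ℕ) [Fact p.Prime], p ≠ 2 → Literature.NumberTheory.EllipticCurves.Rank1Residual.ClassX7 W p → ¬ W.HasCM → W.frobeniusTrace p = 0 → Literature.NumberTheory.EllipticCurves.Rank1Residual.Surj W p → ∃ ε : ℤˣ, Summit.BirchSwinnertonDyer.Rank1Residual.Supersingular.KobayashiLowerDivisibility W p ε)
    (hB2' : ∀ (W : WeierstrassCurve ℚ) [W.IsElliptic] [W.IsGloballyMinimal] (p : ℕ) [Fact p.Prime], p ≠ 2 → Literature.NumberTheory.EllipticCurves.Rank1Residual.ClassX7 W p → ¬ W.HasCM → W.frobeniusTrace p = 0 → ¬ Literature.NumberTheory.EllipticCurves.Rank1Residual.Surj W p → ∃ ε : ℤˣ, Summit.BirchSwinnertonDyer.Rank1Residual.Supersingular.KobayashiMainConjecture W p ε)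
    (hB3 : ∀ (W : WeierstrassCurve ℚ) [W.IsElliptic] [W.IsGloballyMinimal] (p : ℕ) [Fact p.Prime], Literature.NumberTheory.EllipticCurves.Rank1Residual.ClassX8 W p → ∃ (N : ℕ) (_ : NeZero N) (f : CuspForm (CongruenceSubgroup.Gamma0 N) 2) (ϖ : ℚ) (Lsharp Lflat : Literature.NumberTheory.EllipticCurves.IwasawaAlgebra p) (c : Literature.NumberTheory.EllipticCurves.Sprung2017.Chroma) (ξ : Literature.NumberTheory.EllipticCurves.IwasawaAlgebra p), Literature.NumberTheory.EllipticCurves.ModularForms.IsNewformOf W f ∧ (ϖ : ℝ) * W.realPeriodRat = Literature.NumberTheory.EllipticCurves.ModularForms.plusPeriod f ∧ Literature.NumberTheory.EllipticCurves.Sprung2017.IsSprungPair f p (W.frobeniusTrace p) Lsharp Lflat ∧ (⟨ξ, 0, 0⟩ : Summit.BirchSwinnertonDyer.Rank1Residual.Supersingular.SignedDatum W p).EulerCharacteristic ∧ ∃ h : Literature.NumberTheory.EllipticCurves.IwasawaAlgebra p, Literature.NumberTheory.EllipticCurves.iwasawaToPowerSeries p ξ = PowerSeries.C (ϖ : ℚ_[p])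 * Literature.NumberTheory.EllipticCurves.iwasawaToPowerSeries p (Literature.NumberTheory.EllipticCurves.Sprung2017.chromaticL c Lsharp Lflat * h))
    (hR8 : ∀ (W : WeierstrassCurve ℚ) [W.IsElliptic] [W.IsGloballyMinimal] (p : ℕ) [Fact p.Prime], Literature.NumberTheory.EllipticCurves.Rank1Residual.ClassX8 W p → W.analyticRank ≤ 1 → ¬ (W.analyticRank = 0 ∧ Literature.NumberTheory.EllipticCurves.Rank1Residual.Surj W p) → Literature.NumberTheory.EllipticCurves.Rank1Residual.Typed.MissingPPartAt W p)
    (hPub : Literature.NumberTheory.EllipticCurves.Wuthrich2014.sha_dvd_analyticSha ∧ Literature.NumberTheory.EllipticCurves.Kobayashi2003.thm12_signedSelmerDual_finite_torsion ∧ Literature.NumberTheory.EllipticCurves.Kobayashi2003.thm41_signedCharIdeal_divisibility ∧ Literature.NumberTheory.EllipticCurves.BDKim2013.cor315_signedCharValue_rankZero ∧ Literature.NumberTheory.EllipticCurves.BurungaleKobayashiOta2024.corA5_pPart_of_signedCharIdeal_eq ∧ Literature.NumberTheory.EllipticCurves.realPeriodRat_eq_unit_mul_plusPeriod ∧ Literature.NumberTheory.EllipticCurves.realPeriodRat_eq_unit_mul_plusPeriod_three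 ∧ Literature.NumberTheory.EllipticCurves.ModularForms.nonempty_modularParametrizationData ∧ WeierstrassCurve.hasEntireLFunction_rat ∧ Literature.NumberTheory.EllipticCurves.rank_eq_analyticRank_of_analyticRank_le_one) :
    Summit.BirchSwinnertonDyer.Rank1Residual.Supersingular.SignedSupersingular := by
  intro W _ _ p _ hr hcm hp
  obtain ⟨hW, h12, h41, hKim, hA5, h5, h3, hmodP, hmod, hGZK⟩ := hPub
  haveI : Finite W.sha := (hGZK W hr).2
  have hPP := fun h ↦ Literature.NumberTheory.EllipticCurves.Rank1Residual.Typed.missingPPartAt_of_bsdp W p h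
  have hLU := fun h ↦ Literature.NumberTheory.EllipticCurves.Rank1Residual.Typed.lower_and_upper_of_missingPPartAt W p h
  have toX6 : Literature.NumberTheory.EllipticCurves.Rank1Residual.Typed.MissingPPartAt W p → Literature.NumberTheory.EllipticCurves.Rank1Residual.Typed.X6.MissingInputAt W p := fun h ↦
    ⟨fun _ _ _ ↦ (hLU h).1, fun _ ↦ h⟩
  have toX7 : Literature.NumberTheory.EllipticCurves.Rank1Residual.Typed.MissingPPartAt W p → Literature.NumberTheory.EllipticCurves.Rank1Residual.Typed.X7.MissingInputAt W p := fun h ↦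
    ⟨fun _ _ _ ↦ (hLU h).1, fun _ ↦ h⟩
  have toX8 : Literature.NumberTheory.EllipticCurves.Rank1Residual.Typed.MissingPPartAt W p → Literature.NumberTheory.EllipticCurves.Rank1Residual.Typed.X8.MissingInputAt W p := fun h ↦
    ⟨fun _ _ ↦ (hLU h).1, fun _ ↦ h⟩
  -- corner X8 (used twice: directly, and for the `a_3 = ±3` pairs of corner X7 at `p = 3`)
  have hX8 : Literature.NumberTheory.EllipticCurves.Rank1Residual.ClassX8 W p → Literature.NumberTheory.EllipticCurves.Rank1Residual.Typed.X8.MissingInputAt W p := by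
    intro hX
    by_cases hc : W.analyticRank = 0 ∧ Literature.NumberTheory.EllipticCurves.Rank1Residual.Surj W p
    · obtain ⟨N, _, f, ϖ, Lsharp, Lflat, c, ξ, hf, hϖ, hSP, hK, hdiv⟩ := hB3 W p hX
      exact Summit.BirchSwinnertonDyer.Rank1Residual.Supersingular.X8.missingInputAt_of_chromaticLowerDivisibility_of_surj W p hGZK hmod hX hc.2 hc.1
        hf hϖ hSP c ξ hK hdiv
    · exact toX8 (hR8 W p hX hr hc)
  refine ⟨fun hX _ ↦ ?_, fun hX ↦ ?_, hX8⟩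
  · -- corner X6
    obtain ⟨ε, hlow⟩ := hB1 W p hp hX
    exact toX6 (hPP (Summit.BirchSwinnertonDyer.Rank1Residual.Supersingular.X6.bsdp_of_lowerDivisibility W p hW h12 h41 hKim hA5 h5 h3 hmodP hmod hGZK
      hp hX hr ε hlow))
  · -- corner X7
    by_cases hap : W.frobeniusTrace p = 0
    · by_cases hs : Literature.NumberTheory.EllipticCurves.Rank1Residual.Surj W p
      · obtain ⟨ε, hlow⟩ := hB2 W p hp hX hcm hap hs
        exact toX7 (hPP (Summit.BirchSwinnertonDyer.Rank1Residual.Supersingular.X7.bsdp_of_lowerDivisibility_of_surj W p hW h12 h41 hKim hA5 h5 h3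
          hmodP hmod hGZK hp hX hap hs hr ε hlow))
      · obtain ⟨ε, hMC⟩ := hB2' W p hp hX hcm hap hs
        rcases Nat.le_one_iff_eq_zero_or_eq_one.mp hr with h0 | h1
        · exact toX7 (hPP (Summit.BirchSwinnertonDyer.Rank1Residual.Supersingular.bsdp_of_kobayashiMainConjecture_of_analyticRank_eq_zero W p h12 hKim
            Literature.NumberTheory.EllipticCurves.pollack_exists_plusMinusPAdicLFunction_holds hmodP hmod hGZK hp hX.1.1 hap
            (Literature.NumberTheory.EllipticCurves.Rank1Residual.ClassX7.irr W p hp hX) h0 hMC))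
        · exact toX7 (hPP (Summit.BirchSwinnertonDyer.Rank1Residual.Supersingular.X7.bsdp_of_kobayashiMainConjecture_of_corA5_of_analyticRank_eq_one
            W p hA5 hmod hGZK hp hX hap h1 ε hMC))
    · -- `a_p ≠ 0` at a good supersingular prime forces `p = 3`, `a_3 = ±3`: the pair is in corner X8
      have hp3 : p = 3 := by
        by_contra h3'
        have hpr : p.Prime := Fact.out
        have h5p : 5 ≤ p := by
          have h2 := hpr.two_le
          have h4 : p ≠ 4 := by intro h4; rw [h4] at hpr; norm_num at hpr
          omega
        exact hap (Summit.BirchSwinnertonDyer.Rank1Residual.Supersingular.ClassX7.frobeniusTrace_eq_zero_of_five_le W p h5p hX)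
      subst hp3
      have hX' : Literature.NumberTheory.EllipticCurves.Rank1Residual.ClassX8 W 3 := ⟨rfl, hX.1, hap⟩
      obtain ⟨hlow8, hpp8⟩ := hX8 hX'
      exact ⟨fun h0 _ himg ↦ hlow8 h0 himg, fun hc ↦ hpp8 (fun hc' ↦ hc ⟨hc'.1, hp, hc'.2⟩)⟩

end Summit.BirchSwinnertonDyer.BirchSwinnertonDyer.Theorems.SignedSupersingular

end
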